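import Mathlib.Data.Fintype.Sum
import Mathlib.Data.Fintype.Pi
import Literature.Computability.Complexity.PerfectMatchingApproximators
import HarnessLib

/-!
# Razborov's lattice for the logical permanent: the negative test inputs (Jukna 2012, §9.11.2)

The rejected test inputs of Razborov's lower bound for the perfect matching function (Jukna
2012, §9.11, PDF pp. 292–295): a two-colouring `h` of the `2m` vertices of `K_{m,m}` defines
the graph `E₋ = {(u,v) | h(u) = h(v)}` (`colorGraph h`), which has a perfect matching only when
the two sides have equally many `1`-coloured vertices. This file proves the independence
lemmas of §9.11.2 in COUNTING form (all `4^m` colourings, unit weights):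

* `card_filter_flip`, `card_filter_pairs_mul` — the independence mechanism replacing Jukna's
  Lemma 9.35 (GF(2)-rank of a forest): recolouring one vertex is an involution on a set of
  colourings that is invariant under it, so an event it negates holds for exactly half of the
  set; iterating over *fresh* vertices `w₁, …, w_k` (pairwise distinct, none equal to a partner
  `o_i`), the event `∀ i, h(w_i) = h(o_i)` holds for exactly a `2^{-k}` fraction.
* `card_filter_block_mul` — for a matching `D` each of whose edges has an endpoint outside a
  vertex set avoided by `𝓗`'s defining events, `#{h ∈ 𝓗 : D ⊆ E₋(h)} · 2^{|D|} = #𝓗`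
  (Jukna, Lemma 9.35: "the events `(u_i,v_i) ∈ E₋` are independent, each of probability ½",
  for the forests that actually occur).
* `Fresh`, `card_filter_forall_not_subset_mul_le` — along a *fresh sequence* of nonempty
  matchings `D₁, …, D_q` with `≤ s` edges (each edge of `D_t` has an endpoint not covered by
  `D₁ ∪ ⋯ ∪ D_{t-1}`; such a union is a forest), `Prob[∀ t, D_t ⊄ E₋] ≤ (1 - 2^{-s})^q`, i.e.
  `#{h : ∀ t, D_t ⊄ E₋(h)} · (2ˢ)^q ≤ (2ˢ - 1)^q · 4^m` (Jukna, end of proof of Lemma 9.37).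

The selection of fresh sequences (Lemma 9.36), inequality (9.8) and Lemma 9.37 (the negative
error of an approximate join) follow in `PerfectMatchingNegativeError.lean`.

## References

* S. Jukna, *Boolean Function Complexity: Advances and Frontiers*, Springer (2012), §9.11.2,
  Lemmas 9.35, 9.36, 9.37 (PDF pp. 293–295) [Jukna2012].
* A. A. Razborov, *Lower bounds on monotone complexity of the logical permanent*, Mat. Zametki
  37 (1985) 887–900 [Razborov1985b].
-/

namespace Literature.Computability.Complexity

namespace PerfectMatching

open Finset Razborov

variable {m : ℕ}

/-! ### Colourings and the graph `E₋` -/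

/-- The vertices of `K_{m,m}`: left vertices `inl u`, right vertices `inr v`. [folklore] -/
abbrev Vtx (m : ℕ) : Type := Fin m ⊕ Fin m

/-- There are `4^m` two-colourings of the `2m` vertices. [folklore] -/
theorem card_colorings (m : ℕ) : Fintype.card (Vtx m → Bool) = 4 ^ m := by
  rw [Fintype.card_fun, Fintype.card_bool, Fintype.card_sum, Fintype.card_fin,
    show (4 : ℕ) = 2 ^ 2 by norm_num, ← pow_mul, two_mul]

/-- The graph `E₋(h) = {(u, v) | h(u) = h(v)}` of a two-colouring `h` of the vertices (Jukna
2012, §9.11, before Lemma 9.33). [cite: Jukna2012, §9.11 (PDF p. 292)] -/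
def colorGraph (h : Vtx m → Bool) : Finset (Edge m) :=
  univ.filter fun e => h (Sum.inl e.1) = h (Sum.inr e.2)

/-- `E₋(h)` as an input of `f_m`. [cite: Jukna2012, §9.11 (PDF p. 292)] -/
def colorInput (h : Vtx m → Bool) : Edge m → Bool := fun e => decide (h (Sum.inl e.1) = h (Sum.inr e.2))

/-- Membership in `E₋(h)`. [folklore] -/
@[simp] theorem mem_colorGraph {h : Vtx m → Bool} {e : Edge m} :
    e ∈ colorGraph h ↔ h (Sum.inl e.1) = h (Sum.inr e.2) := by
  simp [colorGraph]

/-- The edge set of `colorInput h` is `colorGraph h`. [folklore] -/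
@[simp] theorem edgesOf_colorInput (h : Vtx m → Bool) : edgesOf (colorInput h) = colorGraph h := by
  ext e
  simp [colorInput]

/-- `D ⊆ E₋(h)` edge by edge. [folklore] -/
theorem subset_colorGraph_iff {D : Finset (Edge m)} {h : Vtx m → Bool} :
    D ⊆ colorGraph h ↔ ∀ e ∈ D, h (Sum.inl e.1) = h (Sum.inr e.2) := by
  simp only [subset_iff, mem_colorGraph]

/-- The vertices covered by an edge set. [folklore] -/
def everts (E : Finset (Edge m)) : Finset (Vtx m) :=
  E.image (fun e => Sum.inl e.1) ∪ E.image fun e => Sum.inr e.2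

/-- A left vertex is covered iff it is a left endpoint. [folklore] -/
@[simp] theorem inl_mem_everts {E : Finset (Edge m)} {u : Fin m} :
    (Sum.inl u : Vtx m) ∈ everts E ↔ ∃ e ∈ E, e.1 = u := by
  simp [everts]

/-- A right vertex is covered iff it is a right endpoint. [folklore] -/
@[simp] theorem inr_mem_everts {E : Finset (Edge m)} {v : Fin m} :
    (Sum.inr v : Vtx m) ∈ everts E ↔ ∃ e ∈ E, e.2 = v := by
  simp [everts]

/-- `everts` is monotone. [folklore] -/
theorem everts_mono {D E : Finset (Edge m)} (h : D ⊆ E) : everts D ⊆ everts E :=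
  union_subset_union (image_subset_image h) (image_subset_image h)

/-! ### Recolouring one vertex -/

/-- Recolour the vertex `w` (flip `h w`). [folklore] -/
def flipAt (h : Vtx m → Bool) (w : Vtx m) : Vtx m → Bool := Function.update h w (!h w)

/-- The flipped vertex changes colour. [folklore] -/
@[simp] theorem flipAt_apply_self (h : Vtx m → Bool) (w : Vtx m) : flipAt h w w = !h w := by
  simp [flipAt]

/-- Other vertices keep their colour. [folklore] -/
theorem flipAt_apply_of_ne (h : Vtx m → Bool) {w v : Vtx m} (hv : v ≠ w) : flipAt h w v = h v := by
  simp [flipAt, hv]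

/-- Recolouring twice is the identity. [folklore] -/
@[simp] theorem flipAt_flipAt (h : Vtx m → Bool) (w : Vtx m) : flipAt (flipAt h w) w = h := by
  funext v
  by_cases hv : v = w
  · subst hv
    simp
  · rw [flipAt_apply_of_ne _ hv, flipAt_apply_of_ne _ hv]

/-- Recolouring an uncovered vertex does not change which of the edges are monochromatic.
[folklore] -/
theorem subset_colorGraph_flipAt_iff {D : Finset (Edge m)} {h : Vtx m → Bool} {w : Vtx m}
    (hw : w ∉ everts D) : D ⊆ colorGraph (flipAt h w) ↔ D ⊆ colorGraph h := by
  rw [subset_colorGraph_iff, subset_colorGraph_iff]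
  refine forall₂_congr fun e he => ?_
  have h1 : (Sum.inl e.1 : Vtx m) ≠ w := fun heq => hw (heq ▸ inl_mem_everts.2 ⟨e, he, rfl⟩)
  have h2 : (Sum.inr e.2 : Vtx m) ≠ w := fun heq => hw (heq ▸ inr_mem_everts.2 ⟨e, he, rfl⟩)
  rw [flipAt_apply_of_ne _ h1, flipAt_apply_of_ne _ h2]

/-- **One fair coin.** If a set `𝓗` of colourings is invariant under recolouring the vertex
`w`, an event negated by this recolouring holds for exactly half of `𝓗` (the involution
`h ↦ flipAt h w` exchanges the two halves). This replaces the rank computation of Jukna's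
Lemma 9.35 ("each happens with probability ½"). [cite: Jukna2012, Lemma 9.35] -/
theorem card_filter_flip (𝓗 : Finset (Vtx m → Bool)) (w : Vtx m) (h𝓗 : ∀ h ∈ 𝓗, flipAt h w ∈ 𝓗)
    (Q : (Vtx m → Bool) → Prop) [DecidablePred Q] (hQ : ∀ h, Q (flipAt h w) ↔ ¬ Q h) :
    2 * #(𝓗.filter Q) = #𝓗 := by
  have hbij : #(𝓗.filter Q) = #(𝓗.filter fun h => ¬ Q h) := by
    refine card_bij' (fun h _ => flipAt h w) (fun h _ => flipAt h w) (fun h hh => ?_) (fun h hh => ?_)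
      (fun h _ => flipAt_flipAt h w) (fun h _ => flipAt_flipAt h w)
    · obtain ⟨hh𝓗, hQh⟩ := mem_filter.1 hh
      exact mem_filter.2 ⟨h𝓗 h hh𝓗, fun hc => ((hQ h).1 hc) hQh⟩
    · obtain ⟨hh𝓗, hQh⟩ := mem_filter.1 hh
      exact mem_filter.2 ⟨h𝓗 h hh𝓗, (hQ h).2 hQh⟩
  have hsum := card_filter_add_card_filter_not (s := 𝓗) Q
  omega

/-- **Independent fair coins** (the counting core of Jukna's Lemma 9.35). Let `pairs` be a set of
vertex pairs `(w, o)` with pairwise distinct first components, no second component equal to a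
first component, and let `𝓗` be invariant under recolouring each `w`. Then the colourings in
`𝓗` with `h(w) = h(o)` for all pairs are exactly a `2^{-|pairs|}` fraction of `𝓗`.
[cite: Jukna2012, Lemma 9.35] -/
theorem card_filter_pairs_mul (pairs : Finset (Vtx m × Vtx m)) :
    ∀ 𝓗 : Finset (Vtx m → Bool), Set.InjOn Prod.fst (pairs : Set (Vtx m × Vtx m)) →
      (∀ a ∈ pairs, ∀ b ∈ pairs, a.2 ≠ b.1) → (∀ a ∈ pairs, ∀ h ∈ 𝓗, flipAt h a.1 ∈ 𝓗) →
      #(𝓗.filter fun h => ∀ a ∈ pairs, h a.1 = h a.2) * 2 ^ #pairs = #𝓗 := by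
  classical
  induction pairs using Finset.induction_on with
  | empty =>
    intro 𝓗 _ _ _
    simp
  | insert a P haP ih =>
    intro 𝓗 hinj hsep hinv
    set 𝓗' := 𝓗.filter fun h => h a.1 = h a.2 with h𝓗'def
    have ha : a ∈ insert a P := mem_insert_self a P
    -- the filtered set, in two stages
    have hfilt : (𝓗.filter fun h => ∀ b ∈ insert a P, h b.1 = h b.2) =
        𝓗'.filter fun h => ∀ b ∈ P, h b.1 = h b.2 := by
      rw [h𝓗'def, filter_filter]
      refine filter_congr fun h _ => ?_
      simp only [forall_mem_insert]
    -- the induction hypothesis applies to `𝓗'`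
    have hinj' : Set.InjOn Prod.fst (P : Set (Vtx m × Vtx m)) :=
      hinj.mono (coe_subset.2 (subset_insert a P))
    have hsep' : ∀ b ∈ P, ∀ c ∈ P, b.2 ≠ c.1 :=
      fun b hb c hc => hsep b (mem_insert_of_mem hb) c (mem_insert_of_mem hc)
    have hne1 : ∀ b ∈ P, a.1 ≠ b.1 := by
      intro b hb heq
      have := hinj (mem_coe.2 ha) (mem_coe.2 (mem_insert_of_mem hb)) heq
      exact haP (this ▸ hb)
    have hinv' : ∀ b ∈ P, ∀ h ∈ 𝓗', flipAt h b.1 ∈ 𝓗' := by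
      intro b hb h hh
      obtain ⟨hh𝓗, hha⟩ := mem_filter.1 hh
      refine mem_filter.2 ⟨hinv b (mem_insert_of_mem hb) h hh𝓗, ?_⟩
      rw [flipAt_apply_of_ne _ (hne1 b hb), flipAt_apply_of_ne _ (hsep a ha b (mem_insert_of_mem hb))]
      exact hha
    have hIH := ih 𝓗' hinj' hsep' hinv'
    -- one more fair coin
    have hhalf : 2 * #𝓗' = #𝓗 := by
      refine card_filter_flip 𝓗 a.1 (hinv a ha) _ fun h => ?_
      rw [flipAt_apply_self, flipAt_apply_of_ne _ (hsep a ha a ha)]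
      cases h a.1 <;> cases h a.2 <;> simp
    rw [hfilt, card_insert_of_notMem haP, pow_succ, ← mul_assoc, hIH, mul_comm, hhalf]

/-! ### Blocks: a matching with fresh endpoints -/

/-- **Left-fresh block**: if the edges of `D` have pairwise distinct left endpoints and `𝓗` is
invariant under recolouring these left endpoints, then `#{h ∈ 𝓗 : D ⊆ E₋(h)} · 2^{|D|} = #𝓗`.
[cite: Jukna2012, Lemma 9.35] -/
theorem card_filter_leftBlock_mul {D : Finset (Edge m)} (hD : Set.InjOn Prod.fst (D : Set (Edge m)))
    (𝓗 : Finset (Vtx m → Bool)) (hinv : ∀ e ∈ D, ∀ h ∈ 𝓗, flipAt h (Sum.inl e.1) ∈ 𝓗) :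
    #(𝓗.filter fun h => D ⊆ colorGraph h) * 2 ^ #D = #𝓗 := by
  classical
  set pairs : Finset (Vtx m × Vtx m) := D.image fun e => (Sum.inl e.1, Sum.inr e.2) with hpairs
  have hinjD : Set.InjOn (fun e : Edge m => ((Sum.inl e.1, Sum.inr e.2) : Vtx m × Vtx m)) D := by
    intro e₁ _ e₂ _ heq
    simp only [Prod.mk.injEq, Sum.inl.injEq, Sum.inr.injEq] at heq
    exact Prod.ext heq.1 heq.2
  have hcard : #pairs = #D := card_image_of_injOn hinjD
  have hfilt : (𝓗.filter fun h => D ⊆ colorGraph h) = 𝓗.filter fun h => ∀ a ∈ pairs, h a.1 = h a.2 := by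
    refine filter_congr fun h _ => ?_
    rw [subset_colorGraph_iff, hpairs, forall_mem_image]
  rw [hfilt, ← hcard]
  refine card_filter_pairs_mul pairs 𝓗 ?_ ?_ ?_
  · rintro ⟨a1, a2⟩ ha ⟨b1, b2⟩ hb heq
    obtain ⟨e₁, he₁, h₁⟩ := mem_image.1 (mem_coe.1 ha)
    obtain ⟨e₂, he₂, h₂⟩ := mem_image.1 (mem_coe.1 hb)
    simp only [Prod.mk.injEq] at h₁ h₂
    dsimp only at heq
    subst heq
    have h11 : e₁.1 = e₂.1 := Sum.inl_injective (h₁.1.trans h₂.1.symm)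
    have := hD (mem_coe.2 he₁) (mem_coe.2 he₂) h11
    subst this
    rw [← h₁.2, ← h₂.2]
  · intro a ha b hb
    obtain ⟨e₁, -, rfl⟩ := mem_image.1 ha
    obtain ⟨e₂, -, rfl⟩ := mem_image.1 hb
    exact Sum.inr_ne_inl
  · intro a ha h hh
    obtain ⟨e, he, rfl⟩ := mem_image.1 ha
    exact hinv e he h hh

/-- **Right-fresh block**: the same with the roles of the sides exchanged. [cite: Jukna2012, Lemma 9.35] -/
theorem card_filter_rightBlock_mul {D : Finset (Edge m)} (hD : Set.InjOn Prod.snd (D : Set (Edge m)))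
    (𝓗 : Finset (Vtx m → Bool)) (hinv : ∀ e ∈ D, ∀ h ∈ 𝓗, flipAt h (Sum.inr e.2) ∈ 𝓗) :
    #(𝓗.filter fun h => D ⊆ colorGraph h) * 2 ^ #D = #𝓗 := by
  classical
  set pairs : Finset (Vtx m × Vtx m) := D.image fun e => (Sum.inr e.2, Sum.inl e.1) with hpairs
  have hinjD : Set.InjOn (fun e : Edge m => ((Sum.inr e.2, Sum.inl e.1) : Vtx m × Vtx m)) D := by
    intro e₁ _ e₂ _ heq
    simp only [Prod.mk.injEq, Sum.inl.injEq, Sum.inr.injEq] at heq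
    exact Prod.ext heq.2 heq.1
  have hcard : #pairs = #D := card_image_of_injOn hinjD
  have hfilt : (𝓗.filter fun h => D ⊆ colorGraph h) = 𝓗.filter fun h => ∀ a ∈ pairs, h a.1 = h a.2 := by
    refine filter_congr fun h _ => ?_
    rw [subset_colorGraph_iff, hpairs, forall_mem_image]
    exact forall₂_congr fun e _ => eq_comm
  rw [hfilt, ← hcard]
  refine card_filter_pairs_mul pairs 𝓗 ?_ ?_ ?_
  · rintro ⟨a1, a2⟩ ha ⟨b1, b2⟩ hb heq
    obtain ⟨e₁, he₁, h₁⟩ := mem_image.1 (mem_coe.1 ha)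
    obtain ⟨e₂, he₂, h₂⟩ := mem_image.1 (mem_coe.1 hb)
    simp only [Prod.mk.injEq] at h₁ h₂
    dsimp only at heq
    subst heq
    have h22 : e₁.2 = e₂.2 := Sum.inr_injective (h₁.1.trans h₂.1.symm)
    have := hD (mem_coe.2 he₁) (mem_coe.2 he₂) h22
    subst this
    rw [← h₁.2, ← h₂.2]
  · intro a ha b hb
    obtain ⟨e₁, -, rfl⟩ := mem_image.1 ha
    obtain ⟨e₂, -, rfl⟩ := mem_image.1 hb
    exact Sum.inl_ne_inr
  · intro a ha h hh
    obtain ⟨e, he, rfl⟩ := mem_image.1 ha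
    exact hinv e he h hh

/-- An edge is **fresh** with respect to an edge set `E` if one of its endpoints is not covered
by `E` (Jukna 2012, proof of Lemma 9.36: the new matching "has no edge in `U₀ × V₀`").
[cite: Jukna2012, Lemma 9.36] -/
def FreshEdge (E : Finset (Edge m)) (e : Edge m) : Prop :=
  (Sum.inl e.1 : Vtx m) ∉ everts E ∨ (Sum.inr e.2 : Vtx m) ∉ everts E

/-- **A fresh matching is a block of independent coins** (Jukna 2012, Lemma 9.35 for the forests
arising in Lemma 9.36): if every edge of the matching `D` is fresh with respect to `E` and `𝓗`
is invariant under recolouring any vertex not covered by `E`, then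
`#{h ∈ 𝓗 : D ⊆ E₋(h)} · 2^{|D|} = #𝓗`. Proof: first the edges with a fresh LEFT endpoint, then,
inside the resulting set, the remaining edges, whose RIGHT endpoints are fresh and distinct from
all right endpoints already used. [cite: Jukna2012, Lemma 9.35] -/
theorem card_filter_block_mul {D E : Finset (Edge m)} (hD : IsMatching D) (hfresh : ∀ e ∈ D, FreshEdge E e)
    (𝓗 : Finset (Vtx m → Bool)) (hinv : ∀ w ∉ everts E, ∀ h ∈ 𝓗, flipAt h w ∈ 𝓗) :
    #(𝓗.filter fun h => D ⊆ colorGraph h) * 2 ^ #D = #𝓗 := by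
  classical
  set DL := D.filter fun e => (Sum.inl e.1 : Vtx m) ∉ everts E with hDL
  set DR := D.filter fun e => ¬ (Sum.inl e.1 : Vtx m) ∉ everts E with hDR
  set 𝓗₁ := 𝓗.filter fun h => DL ⊆ colorGraph h with h𝓗₁
  -- stage 1: left-fresh edges
  have h1 : #𝓗₁ * 2 ^ #DL = #𝓗 := by
    refine card_filter_leftBlock_mul (fun e₁ h₁ e₂ h₂ heq => ?_) 𝓗 fun e he h hh => ?_
    · exact hD.1 e₁ (mem_filter.1 (mem_coe.1 h₁)).1 e₂ (mem_filter.1 (mem_coe.1 h₂)).1 heq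
    · exact hinv _ (mem_filter.1 he).2 h hh
  -- stage 2: the remaining edges have fresh right endpoints
  have hRfresh : ∀ e ∈ DR, (Sum.inr e.2 : Vtx m) ∉ everts E := by
    intro e he
    obtain ⟨heD, hl⟩ := mem_filter.1 he
    rcases hfresh e heD with h | h
    · exact absurd h hl
    · exact h
  have hRnotL : ∀ e ∈ DR, (Sum.inr e.2 : Vtx m) ∉ everts DL := by
    intro e he hmem
    obtain ⟨e', he', h2⟩ := inr_mem_everts.1 hmem
    have heD : e ∈ D := (mem_filter.1 he).1
    have he'D : e' ∈ D := (mem_filter.1 he').1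
    have : e' = e := hD.2 e' he'D e heD h2
    subst this
    exact (mem_filter.1 he).2 (mem_filter.1 he').2
  have h2 : #(𝓗₁.filter fun h => DR ⊆ colorGraph h) * 2 ^ #DR = #𝓗₁ := by
    refine card_filter_rightBlock_mul (fun e₁ h₁ e₂ h₂ heq => ?_) 𝓗₁ fun e he h hh => ?_
    · exact hD.2 e₁ (mem_filter.1 (mem_coe.1 h₁)).1 e₂ (mem_filter.1 (mem_coe.1 h₂)).1 heq
    · obtain ⟨hh𝓗, hhL⟩ := mem_filter.1 hh
      exact mem_filter.2 ⟨hinv _ (hRfresh e he) h hh𝓗,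
        (subset_colorGraph_flipAt_iff (hRnotL e he)).2 hhL⟩
  -- assemble
  have hfilt : (𝓗₁.filter fun h => DR ⊆ colorGraph h) = 𝓗.filter fun h => D ⊆ colorGraph h := by
    rw [h𝓗₁, filter_filter]
    refine filter_congr fun h _ => ?_
    rw [← union_subset_iff, hDL, hDR, filter_union_filter_not_eq]
  have hcardD : #DL + #DR = #D := by
    rw [hDL, hDR]
    exact card_filter_add_card_filter_not _
  rw [← hfilt, ← hcardD, pow_add, mul_comm (2 ^ #DL), ← mul_assoc, h2, h1]

/-! ### Fresh sequences of matchings -/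

/-- The union of the edge sets of a list. [folklore] -/
def edgesL : List (Finset (Edge m)) → Finset (Edge m)
  | [] => ∅
  | D :: Ds => D ∪ edgesL Ds

/-- Membership in `edgesL`. [folklore] -/
theorem mem_edgesL {e : Edge m} : ∀ {Ds : List (Finset (Edge m))}, e ∈ edgesL Ds ↔ ∃ D ∈ Ds, e ∈ D
  | [] => by simp [edgesL]
  | D :: Ds => by
    rw [edgesL, mem_union, mem_edgesL]
    simp

/-- Members of the list are contained in `edgesL`. [folklore] -/
theorem subset_edgesL_of_mem {Ds : List (Finset (Edge m))} {D : Finset (Edge m)} (hD : D ∈ Ds) :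
    D ⊆ edgesL Ds := fun _ he => mem_edgesL.2 ⟨D, hD, he⟩

/-- `|edgesL Ds| ≤ s · |Ds|` when every member has at most `s` edges. [folklore] -/
theorem card_edgesL_le {s : ℕ} : ∀ {Ds : List (Finset (Edge m))}, (∀ D ∈ Ds, #D ≤ s) →
    #(edgesL Ds) ≤ s * Ds.length
  | [], _ => by simp [edgesL]
  | D :: Ds, h => by
    rw [edgesL, List.length_cons, Nat.mul_succ, add_comm]
    exact (card_union_le _ _).trans (Nat.add_le_add (h D (by simp))
      (card_edgesL_le fun D' hD' => h D' (by simp [hD'])))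

/-- A **fresh sequence** of edge sets, latest first: each member's edges are fresh with respect
to the union of the LATER members of the list (= the earlier blocks). The union of a fresh
sequence of matchings is a forest; this is the order in which Jukna's Lemma 9.36 builds `ℱ₀`.
[cite: Jukna2012, Lemma 9.36] -/
def Fresh : List (Finset (Edge m)) → Prop
  | [] => True
  | D :: Ds => Fresh Ds ∧ ∀ e ∈ D, FreshEdge (edgesL Ds) e

/-- **Probability that no block is monochromatic** (Jukna 2012, end of the proof of Lemma 9.37:
"`Prob[E* ⊄ E₋ for all E* ∈ ℱ₀] = ∏ Prob[E* ⊄ E₋] ≤ (1 - 2^{-s})^{|ℱ₀|}`", with Lemma 9.35), in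
counting form: along a fresh sequence of `q` nonempty matchings with at most `s` edges each,
`#{h : ∀ t, D_t ⊄ E₋(h)} · (2ˢ)^q ≤ (2ˢ - 1)^q · 4^m`. [cite: Jukna2012, Lemma 9.37] -/
theorem card_filter_forall_not_subset_mul_le {s : ℕ} : ∀ (Ds : List (Finset (Edge m))), Fresh Ds →
    (∀ D ∈ Ds, IsMatching D ∧ D.Nonempty ∧ #D ≤ s) →
    #(univ.filter fun h : Vtx m → Bool => ∀ D ∈ Ds, ¬ D ⊆ colorGraph h) * (2 ^ s) ^ Ds.length ≤
      (2 ^ s - 1) ^ Ds.length * 4 ^ m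
  | [], _, _ => by simp [← card_colorings m]
  | D :: Ds, hF, hDs => by
    classical
    obtain ⟨hFDs, hfresh⟩ := hF
    have hD := hDs D (by simp)
    have ih := card_filter_forall_not_subset_mul_le Ds hFDs fun D' hD' => hDs D' (by simp [hD'])
    set 𝓗 := univ.filter fun h : Vtx m → Bool => ∀ D' ∈ Ds, ¬ D' ⊆ colorGraph h with h𝓗
    -- `𝓗` only looks at covered vertices
    have hinv : ∀ w ∉ everts (edgesL Ds), ∀ h ∈ 𝓗, flipAt h w ∈ 𝓗 := by
      intro w hw h hh
      refine mem_filter.2 ⟨mem_univ _, fun D' hD' => ?_⟩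
      rw [subset_colorGraph_flipAt_iff fun hw' => hw (everts_mono (subset_edgesL_of_mem hD') hw')]
      exact (mem_filter.1 hh).2 D' hD'
    have hblock := card_filter_block_mul hD.1 hfresh 𝓗 hinv
    -- the new set is `𝓗` minus the block event
    have hnew : (univ.filter fun h : Vtx m → Bool => ∀ D' ∈ D :: Ds, ¬ D' ⊆ colorGraph h) =
        𝓗.filter fun h => ¬ D ⊆ colorGraph h := by
      rw [h𝓗, filter_filter]
      refine filter_congr fun h _ => ?_
      simp only [List.forall_mem_cons, and_comm]
    have hsplit : #(𝓗.filter fun h => D ⊆ colorGraph h) + #(𝓗.filter fun h => ¬ D ⊆ colorGraph h) = #𝓗 :=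
      card_filter_add_card_filter_not _
    set a := #𝓗 with ha
    set b := #(𝓗.filter fun h => D ⊆ colorGraph h) with hb
    set c := #(𝓗.filter fun h => ¬ D ⊆ colorGraph h) with hc
    have hk1 : 1 ≤ #D := card_pos.2 hD.2.1
    have hks : #D ≤ s := hD.2.2
    -- `c · 2^s ≤ a · (2^s - 1)`
    have hstep : c * 2 ^ s ≤ a * (2 ^ s - 1) := by
      have h2k : 2 ^ #D ≤ 2 ^ s := Nat.pow_le_pow_right (by norm_num) hks
      have hc' : c = b * 2 ^ #D - b := by omega
      have h1 : c * 2 ^ s = b * (2 ^ (#D + s) - 2 ^ s) := by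
        rw [hc', Nat.sub_mul, Nat.mul_sub, pow_add, mul_assoc]
      have h2 : a * (2 ^ s - 1) = b * (2 ^ (#D + s) - 2 ^ #D) := by
        rw [← hblock, Nat.mul_sub, mul_one, mul_assoc, ← pow_add, Nat.mul_sub]
      rw [h1, h2]
      exact Nat.mul_le_mul_left _ (Nat.sub_le_sub_left h2k _)
    rw [hnew, List.length_cons, pow_succ, pow_succ]
    calc c * ((2 ^ s) ^ Ds.length * 2 ^ s) = c * 2 ^ s * (2 ^ s) ^ Ds.length := by ring
      _ ≤ a * (2 ^ s - 1) * (2 ^ s) ^ Ds.length := Nat.mul_le_mul_right _ hstep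
      _ = (2 ^ s - 1) * (a * (2 ^ s) ^ Ds.length) := by ring
      _ ≤ (2 ^ s - 1) * ((2 ^ s - 1) ^ Ds.length * 4 ^ m) := Nat.mul_le_mul_left _ ih
      _ = (2 ^ s - 1) ^ Ds.length * (2 ^ s - 1) * 4 ^ m := by ring

end PerfectMatching

end Literature.Computability.Complexity
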